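import Summits.Ventures.GridStability.Models.SwingTubeChain
import Summits.Ventures.GridStability.Models.WSCC9FaultOnTubeLegs36

/-!
# WSCC9FaultOnTubeGeneric36 — the WSCC9 bus-7 fault-on chain RE-DERIVED through the GENERIC n-machine integrator (instance + kernel cross-check)

Venture GRIDFUSION (LADDER-GRIDFUSION G1-cct, #92-cand «G1cct-WSCC9-FAULT-TUBE36»; seat gridfusion-model-1 g6).  The fault-on model
`WSCC9.faultBus7Printed` IS the cast of the rational data `faultBus7Q : SwingTube.SwingQ 3 := ⟨M, D_SP, P′, E, G_fault7, B_fault7⟩`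
(`faultBus7Q_toModel`, `rfl`), and the SAME 36 legs (`FaultOnLeg.legs36`, mapped field-by-field to `SwingTube.Leg 3`) pass the GENERIC chain
check `SwingTube.chainOK` — whose field test is the natural interval extension of ALL coupling terms with the monotonicity-aware term enclosure
(`SwingTube.termLo/termHi`), a different kernel computation from the hand-specialised `FaultOnLeg.Leg.fieldOK` — in ONE `decide`
(`legs36g_chainOK`).  Consequences: `faultBus7_tube36g` (K-box + re-based tube on every leg, from the generic `SwingTube.tube_of_chainOK`),
`faultBus7_clearingState36g` (sign-free slice boxes), and `kboxAt_legs36g` (the generic chain's K-boxes ARE the specific chain's, leg by leg —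
`SwingTube.Leg.next` and `FaultOnLeg.Leg.next` are the same arithmetic).  So #92's tube now has two independent kernel derivations of its field
bounds.  THREE COLUMNS: CERTIFIED = tube sentences for MODEL M′ (classical WSCC9, MV-2 + MV-P + MV-SPD + MV-h12, bolted fault at bus 7, printed
pre-fault point at synchronous speed); VALIDATED = RK4 arc / model-4 Row TK36; no stability claim.
[cite: Moore1979, §8.1 eqs. (8.5), (8.10); AndersonFouad1977, Example 2.6 / §2.10]
-/

noncomputable section

open Real Set

namespace Summit.Ventures.GridStability.Models

namespace WSCC9

namespace FaultOnLeg

/-- The bus-7 FAULT-ON model as rational swing data: `(M, D_SP, P′, E, G_fault7, B_fault7)`. -/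
def faultBus7Q : SwingTube.SwingQ 3 := ⟨M, D_SP, Pprinted, E, G_fault7, B_fault7⟩

/-- The cast of the rational data IS `faultBus7Printed`. -/
theorem faultBus7Q_toModel : faultBus7Q.toModel = faultBus7Printed := rfl

/-- Field-by-field transport of a WSCC9 leg to the generic leg type. -/
def ofLeg (g : Leg) : SwingTube.Leg 3 := ⟨g.τ, g.A, g.B, g.C, g.D, g.L, g.H⟩

/-- Field-by-field transport of a WSCC9 K-box to the generic box type. -/
def ofKBox (K : KBox6) : SwingTube.KBox 3 := ⟨K.qlo, K.qhi, K.wlo, K.whi⟩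

/-- The two box types have the same state sets. -/
theorem toSet_ofKBox (K : KBox6) (r : ℝ) : (ofKBox K).toSet r = K.toSet r := rfl

/-- The two leg types have the same tube sets. -/
theorem tubeSet_ofLeg (g : Leg) (xa : ClassicalSwing.State 3) (s : ℝ) : (ofLeg g).tubeSet xa s = g.tubeSet xa s := rfl

/-- `next` commutes with the transport (same arithmetic). -/
theorem next_ofLeg (g : Leg) (K : KBox6) : (ofLeg g).next (ofKBox K) = ofKBox (g.next K) := rfl

/-- `kboxAt` commutes with the transport. -/
theorem kboxAt_map : ∀ (legs : List Leg) (K : KBox6) (k : ℕ),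
    SwingTube.kboxAt (ofKBox K) (legs.map ofLeg) k = ofKBox (kboxAt K legs k)
  | [], _, 0 => rfl
  | [], _, _ + 1 => rfl
  | _ :: _, _, 0 => rfl
  | g :: gs, K, k + 1 => by
    simp only [List.map_cons, SwingTube.kboxAt, kboxAt, next_ofLeg]
    exact kboxAt_map gs (g.next K) k

/-- `startAt` commutes with the transport. -/
theorem startAt_map : ∀ (legs : List Leg) (a : ℚ) (k : ℕ), SwingTube.startAt a (legs.map ofLeg) k = startAt a legs k
  | [], _, 0 => rfl
  | [], _, _ + 1 => rfl
  | _ :: _, _, 0 => rfl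
  | g :: gs, a, k + 1 => by
    simp only [List.map_cons, SwingTube.startAt, startAt]
    exact startAt_map gs (a + g.τ) k

/-- The 36 legs in the generic leg type. -/
def legs36g : List (SwingTube.Leg 3) := legs36.map ofLeg

/-- `|legs36g| = 36`. -/
theorem legs36g_length : legs36g.length = 36 := by simp [legs36g, legs36_length]

/-- **KERNEL CROSS-CHECK: the GENERIC chain check passes on the same 36 legs** (interval extension of all coupling terms with the
monotonicity-aware term enclosure; an evaluation path independent of `FaultOnLeg.Leg.fieldOK`). -/
theorem legs36g_chainOK : SwingTube.chainOK faultBus7Q (ofKBox K0) legs36g = true := by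
  decide +kernel

/-- The generic chain's K-boxes are the specific chain's K-boxes. -/
theorem kboxAt_legs36g (k : ℕ) : SwingTube.kboxAt (ofKBox K0) legs36g k = ofKBox (kboxAt K0 legs36 k) :=
  kboxAt_map legs36 K0 k

/-- **THE 36-LEG TUBE via the generic integrator.**  For `k < 36`, `T ∈ [k/200, (k+1)/200]`, every solution `Y` of `faultBus7Printed` on
`[0, T]` from the printed pre-fault point at synchronous speed: the state at `k/200` lies in the K-box `kboxAt K₀ legs36 k` and, for every
`t ∈ [k/200, T]`, in the re-based tube of leg `k` — the SAME sets as `faultBus7_tube36`, obtained through `SwingTube.tube_of_chainOK`.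
MODELLED: classical WSCC9 fault-on model M′. [cite: Moore1979, §8.1 eq. (8.10)] -/
theorem faultBus7_tube36g {k : ℕ} (hk : k < 36) {T : ℝ} (hT1 : (k : ℝ) / 200 ≤ T) (hT2 : T ≤ ((k : ℝ) + 1) / 200)
    {Y : ℝ → ClassicalSwing.State 3} (hY : faultBus7Printed.IsSolutionOn Y (Icc 0 T)) (hω0 : (Y 0).2 = 0)
    (ha2 : (Y 0).1 1 - (Y 0).1 0 ∈ a2Window) (ha3 : (Y 0).1 2 - (Y 0).1 0 ∈ a3Window) :
    Y ((k : ℝ) / 200) ∈ (kboxAt K0 legs36 k).toSet ((Y 0).1 0) ∧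
      ∀ t ∈ Icc ((k : ℝ) / 200) T, Y t ∈ (legAt legs36 k).tubeSet (Y ((k : ℝ) / 200)) (t - (k : ℝ) / 200) := by
  have hk' : k < legs36g.length := by rw [legs36g_length]; exact hk
  have hs : SwingTube.startAt 0 legs36g k = (k : ℚ) / 200 := by
    rw [legs36g, startAt_map]; exact legs36_startAt ⟨k, by omega⟩
  have hleg : SwingTube.legAt legs36g k = ofLeg (legAt legs36 k) := by
    simp only [SwingTube.legAt, legAt, legs36g, List.getD_eq_getElem?_getD, List.getElem?_map]
    rw [List.getElem?_eq_getElem (by rw [legs36_length]; exact hk)]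
    rfl
  have hτ : (SwingTube.legAt legs36g k).τ = 1 / 200 := by rw [hleg]; exact legs36_τ ⟨k, hk⟩
  have e1 : ((SwingTube.startAt 0 legs36g k : ℚ) : ℝ) = (k : ℝ) / 200 := by rw [hs]; push_cast; ring
  have h0 : Y 0 ∈ (ofKBox K0).toSet ((Y 0).1 0) := by rw [toSet_ofKBox]; exact K0_holds hω0 ha2 ha3
  have hY' : faultBus7Q.toModel.IsSolutionOn Y (Icc 0 T) := by rw [faultBus7Q_toModel]; exact hY
  have h := SwingTube.tube_of_chainOK legs36g_chainOK hk' (T := T) (by rw [e1]; exact hT1)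
    (by rw [e1, hτ]; push_cast; linarith) hY' h0
  rw [e1, kboxAt_legs36g, toSet_ofKBox, hleg] at h
  exact ⟨h.1, fun t ht => by simpa only [tubeSet_ofLeg] using h.2 t ht⟩

/-- **THE CLEARING STATE in the SIGN-FREE generic slice box.**  For `k < 36`, `0 ≤ sa ≤ sb ≤ 1/200`, `T ∈ [k/200 + sa, k/200 + sb]` and every
fault-on solution `Y` as above: `Y T ∈ (ofLeg (legAt legs36 k)).sliceBox (ofKBox (kboxAt K₀ legs36 k)) sa sb` (relative angles `δ_i − δ₁`,
printed speeds; the min/max hull formulas of `SwingTube.Leg.sliceBox`).  MODELLED: classical WSCC9 fault-on model M′.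
[cite: Moore1979, §8.1 eq. (8.10)] -/
theorem faultBus7_clearingState36g {k : ℕ} (hk : k < 36) {sa sb : ℚ}
    (hs : (ofLeg (legAt legs36 k)).sliceOK sa sb = true) {T : ℝ}
    (hT1 : (k : ℝ) / 200 + (sa : ℝ) ≤ T) (hT2 : T ≤ (k : ℝ) / 200 + (sb : ℝ))
    {Y : ℝ → ClassicalSwing.State 3} (hY : faultBus7Printed.IsSolutionOn Y (Icc 0 T)) (hω0 : (Y 0).2 = 0)
    (ha2 : (Y 0).1 1 - (Y 0).1 0 ∈ a2Window) (ha3 : (Y 0).1 2 - (Y 0).1 0 ∈ a3Window) :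
    Y T ∈ ((ofLeg (legAt legs36 k)).sliceBox (ofKBox (kboxAt K0 legs36 k)) sa sb).toSet := by
  have hk' : k < legs36g.length := by rw [legs36g_length]; exact hk
  have hst : SwingTube.startAt 0 legs36g k = (k : ℚ) / 200 := by
    rw [legs36g, startAt_map]; exact legs36_startAt ⟨k, by omega⟩
  have hleg : SwingTube.legAt legs36g k = ofLeg (legAt legs36 k) := by
    simp only [SwingTube.legAt, legAt, legs36g, List.getD_eq_getElem?_getD, List.getElem?_map]
    rw [List.getElem?_eq_getElem (by rw [legs36_length]; exact hk)]
    rfl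
  have e1 : ((SwingTube.startAt 0 legs36g k : ℚ) : ℝ) = (k : ℝ) / 200 := by rw [hst]; push_cast; ring
  have h0 : Y 0 ∈ (ofKBox K0).toSet ((Y 0).1 0) := by rw [toSet_ofKBox]; exact K0_holds hω0 ha2 ha3
  have hY' : faultBus7Q.toModel.IsSolutionOn Y (Icc 0 T) := by rw [faultBus7Q_toModel]; exact hY
  have h := SwingTube.clearingState_of_chainOK legs36g_chainOK hk' (sa := sa) (sb := sb) (by rw [hleg]; exact hs)
    (T := T) (by rw [e1]; exact hT1) (by rw [e1]; exact hT2) hY' h0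
  rw [kboxAt_legs36g, hleg] at h
  exact h

end FaultOnLeg

end WSCC9

end Summit.Ventures.GridStability.Models

end
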